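import Mathlib
import Summits.ValiantsHypothesis.ValiantsHypothesis.Theorems.AlgebraicKWGamesOneAlternationLowerBoundGeneric

/-!
# One-alternation algebraic KW protocols: transcendence bookkeeping and the contradiction

Support lemmas for item `stmt-ValiantsHypothesis-10302` (`…Theses.AlgebraicKWGames.OneAlternationLowerBound`),
continuing `…OneAlternationLowerBoundRun` / `…Generic`.  We use Mathlib's matroid of algebraically
independent subsets of the domain `ℂ[x, y]` (`AlgebraicIndependent.matroid`), whose closure operator is
"algebraic over the generated subalgebra" (`AlgebraicIndependent.matroid_closure_eq`):

* `Protocol.isAlgebraic_of_killed` (E1): if identifying `y_e ↦ x_e` kills a nonzero generic message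
  on `E`, then `x_e` is algebraic over Alice's messages, the `x_E` and the remaining free `y`'s;
* `mem_closure_of_mem_closure_union_YC` (E2, matroid exchange): free `y`-variables can be dropped
  from such a closure;
* `Protocol.false` : iterating, the identified cells stay inside the closure of Alice's `≤ T`
  messages, so after `T + 1` adversary rounds we exceed the rank — there is no correct protocol of
  depth `T` with Alice speaking first and Bob second once `T + 2 ≤ n²`.

Honest framing: a toy-model lower bound (one alternation); nothing here bears on VP versus VNP.
-/

open MvPolynomial

-- the summit and the problem share the name `ValiantsHypothesis` (D-0017 single-conjunct layout)
set_option linter.dupNamespace false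

namespace Summit.ValiantsHypothesis.ValiantsHypothesis.Theorems.AlgebraicKWGames.OneAlt

open scoped Classical

noncomputable section

variable {n : ℕ}

/-! ## The algebraic-independence matroid of `ℂ[x, y]` -/

/-- The matroid of `ℂ`-algebraically independent subsets of `ℂ[x, y]`. -/
abbrev Mat (n : ℕ) : Matroid (R n) := AlgebraicIndependent.matroid ℂ (R n)

/-- Matroid closure = algebraic over the generated subalgebra (`AlgebraicIndependent.matroid_closure_eq`). -/
theorem mem_closure_iff_isAlgebraic (S : Set (R n)) (a : R n) :
    a ∈ (Mat n).closure S ↔ IsAlgebraic (Algebra.adjoin ℂ S) a := by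
  rw [AlgebraicIndependent.matroid_closure_eq]
  exact Subalgebra.mem_algebraicClosure _ _

/-- Any set of variables is independent. -/
theorem indep_image_X (V : Set (Var n)) : (Mat n).Indep ((fun v => (X v : R n)) '' V) := by
  rw [AlgebraicIndependent.matroid_indep_iff]
  have h := (MvPolynomial.algebraicIndependent_X (Var n) ℂ).to_subtype_range
  exact h.mono (Set.image_subset_range _ _)

/-- All of Alice's variables. -/
def Xall : Set (R n) := Set.range fun c : Cell n => (X (Sum.inl c) : R n)

/-- `x`-variables together with some `y`-variables, as an image of `X`. -/
theorem Xall_union_YC_eq (S : Set (Cell n)) :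
    (Xall ∪ YC S : Set (R n)) = (fun v => (X v : R n)) '' (Set.range Sum.inl ∪ Sum.inr '' S) := by
  ext q
  simp only [Xall, YC, Set.mem_union, Set.mem_range, Set.mem_image]
  constructor
  · rintro (⟨c, rfl⟩ | ⟨c, hc, rfl⟩)
    · exact ⟨Sum.inl c, Or.inl ⟨c, rfl⟩, rfl⟩
    · exact ⟨Sum.inr c, Or.inr ⟨c, hc, rfl⟩, rfl⟩
  · rintro ⟨v, hv, rfl⟩
    rcases hv with ⟨c, rfl⟩ | ⟨c, hc, rfl⟩
    · exact Or.inl ⟨c, rfl⟩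
    · exact Or.inr ⟨c, hc, rfl⟩

/-- `x`-variables together with any `y`-variables are independent. -/
theorem indep_Xall_union_YC (S : Set (Cell n)) : (Mat n).Indep (Xall ∪ YC S : Set (R n)) := by
  rw [Xall_union_YC_eq]
  exact indep_image_X _

/-- A `y`-variable is not an `x`-variable. -/
theorem X_inr_not_mem_Xall (c : Cell n) : (X (Sum.inr c) : R n) ∉ (Xall : Set (R n)) := by
  rintro ⟨c', h⟩
  exact Sum.inl_ne_inr (X_injective (σ := Var n) (R := ℂ) h)

/-- Membership of a `y`-variable in `YC S`. -/
theorem X_inr_mem_YC_iff (c : Cell n) (S : Set (Cell n)) : (X (Sum.inr c) : R n) ∈ YC S ↔ c ∈ S := by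
  constructor
  · rintro ⟨c', hc', h⟩
    have := X_injective (σ := Var n) (R := ℂ) h
    rw [Sum.inr.injEq] at this
    exact this ▸ hc'
  · exact fun h => ⟨c, h, rfl⟩

/-- Elements of `ℂ[x]` are in the closure of the `x`-variables. -/
theorem mem_closure_Xall_of_mem_xSub {q : R n} (hq : q ∈ xSub) : q ∈ (Mat n).closure Xall := by
  rw [mem_closure_iff_isAlgebraic]
  exact isAlgebraic_algebraMap (⟨q, hq⟩ : Algebra.adjoin ℂ (Xall : Set (R n)))

/-! ## E2: free `y`-variables can be dropped from a closure -/

/-- **Exchange step.**  If `Z ⊆ cl(x)` and `a ∈ cl(x)`, then `a ∈ cl(Z ∪ {y_w : w ∈ W})` forces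
`a ∈ cl(Z)`: the `y`-variables are algebraically independent over `ℂ[x]`. -/
theorem mem_closure_of_mem_closure_union_YC (Z : Set (R n)) (hZ : Z ⊆ (Mat n).closure Xall)
    {a : R n} (ha : a ∈ (Mat n).closure Xall) (W : Finset (Cell n))
    (h : a ∈ (Mat n).closure (Z ∪ YC (W : Set (Cell n)))) : a ∈ (Mat n).closure Z := by
  induction W using Finset.induction_on with
  | empty => simpa [YC] using h
  | insert w W hw ih =>
    have hins : (Z ∪ YC (↑(insert w W) : Set (Cell n)) : Set (R n)) =
        insert (X (Sum.inr w)) (Z ∪ YC (W : Set (Cell n))) := by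
      rw [Finset.coe_insert, YC, Set.image_insert_eq, Set.union_insert]; rfl
    rw [hins] at h
    by_cases hcase : a ∈ (Mat n).closure (Z ∪ YC (W : Set (Cell n)))
    · exact ih hcase
    · exfalso
      have hex := Matroid.closure_exchange ⟨h, hcase⟩
      -- `y_w ∈ cl (insert a (Z ∪ Y_W)) ⊆ cl (Xall ∪ Y_W)`
      have hsub : insert a (Z ∪ YC (W : Set (Cell n))) ⊆
          (Mat n).closure (Xall ∪ YC (W : Set (Cell n))) := by
        intro q hq
        rcases hq with rfl | hq | hq
        · exact (Mat n).closure_subset_closure Set.subset_union_left ha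
        · exact (Mat n).closure_subset_closure Set.subset_union_left (hZ hq)
        · exact (Mat n).subset_closure (Xall ∪ YC (W : Set (Cell n))) (by simp) (Or.inr hq)
      have hyw : (X (Sum.inr w) : R n) ∈ (Mat n).closure (Xall ∪ YC (W : Set (Cell n))) :=
        (Mat n).closure_subset_closure_of_subset_closure hsub hex.1
      -- but `Xall ∪ Y_(insert w W)` is independent and contains `y_w`
      have hI := indep_Xall_union_YC (n := n) (↑(insert w W) : Set (Cell n))
      have hywI : (X (Sum.inr w) : R n) ∈ (Xall ∪ YC (↑(insert w W) : Set (Cell n)) : Set (R n)) :=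
        Or.inr ⟨w, by simp, rfl⟩
      have hnot := hI.notMem_closure_sdiff_of_mem hywI
      apply hnot
      refine (Mat n).closure_subset_closure ?_ hyw
      intro q hq
      refine ⟨?_, ?_⟩
      · rcases hq with hq | ⟨c, hc, rfl⟩
        · exact Or.inl hq
        · exact Or.inr ⟨c, by simp [hc], rfl⟩
      · rintro rfl
        rcases hq with hq | hq
        · exact X_inr_not_mem_Xall w hq
        · exact hw ((X_inr_mem_YC_iff w _).mp hq)

/-! ## E1: a killed message makes `x_e` algebraic -/

variable {T : ℕ} (P : Protocol n T)

namespace Protocol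

/-- **E1.**  If `e ∉ E` and identifying `y_e ↦ x_e` (on top of `E`) kills a nonzero generic message of
a round `< T` on `E`, then `x_e` is algebraic over the subalgebra generated by Alice's messages, the
`x_E` and the `y`'s outside `insert e E`. -/
theorem isAlgebraic_of_killed (E : Finset (Cell n)) {e : Cell n} (he : e ∉ E) {t : ℕ} (ht : t < T)
    (hne : P.gen E t ≠ 0) (hkill : subst (insert e E) (P.gen E t) = 0) :
    IsAlgebraic (Algebra.adjoin ℂ (P.AM ∪ XE E ∪ YC (↑(insert e E) : Set (Cell n))ᶜ))
      (X (Sum.inl e) : R n) := by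
  set S : Set (R n) := P.AM ∪ XE E ∪ YC (↑(insert e E) : Set (Cell n))ᶜ with hS
  set A : Subalgebra ℂ (R n) := Algebra.adjoin ℂ S with hA
  set F : Finset (Cell n) := insert e E with hF
  -- `subst F` fixes `A` pointwise
  have hfixS : ∀ s ∈ S, subst F s = s := by
    rintro s ((hs | ⟨c, -, rfl⟩) | ⟨c, hc, rfl⟩)
    · exact subst_eq_self_of_mem_xSub F (P.AM_subset_xSub hs)
    · exact subst_X_inl F c
    · have hc' : c ∉ F := fun h => hc (by simpa [hF] using h)
      simp [hc']
  have hfixA : ∀ a ∈ A, subst F a = a := fun a ha => by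
    simpa using algHom_apply_eq_of_eqOn (subst F) (AlgHom.id ℂ (R n))
      (by intro s hs; simpa using hfixS s hs) ha
  -- the killed message lies in `A[y_e]`
  have hmem : P.gen E t ∈ Algebra.adjoin ℂ (P.AM ∪ XE E ∪ YC (↑E : Set (Cell n))ᶜ) :=
    P.gen_mem_adjoin E t ht
  have hunion : (P.AM ∪ XE E ∪ YC (↑E : Set (Cell n))ᶜ : Set (R n)) = S ∪ {X (Sum.inr e)} := by
    have hcompl : ((↑E : Set (Cell n))ᶜ) = insert e ((↑(insert e E) : Set (Cell n))ᶜ) := by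
      ext c
      simp only [Set.mem_compl_iff, Finset.mem_coe, Set.mem_insert_iff, Finset.mem_insert, not_or]
      constructor
      · intro hc
        by_cases hce : c = e
        · exact Or.inl hce
        · exact Or.inr ⟨hce, hc⟩
      · rintro (rfl | ⟨-, hc⟩)
        · exact he
        · exact hc
    rw [hcompl, YC, Set.image_insert_eq, hS, YC]
    ext q; simp only [Set.mem_union, Set.mem_insert_iff, Set.mem_singleton_iff]; tauto
  rw [hunion, Algebra.adjoin_union_eq_adjoin_adjoin, Subalgebra.mem_restrictScalars, ← hA,
    Algebra.adjoin_singleton_eq_range_aeval] at hmem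
  obtain ⟨q, hq⟩ : ∃ q : Polynomial A, Polynomial.aeval (X (Sum.inr e) : R n) q = P.gen E t :=
    (AlgHom.mem_range _).mp hmem
  -- transport along the `A`-algebra map `subst F`
  let σA : R n →ₐ[A] R n :=
    { (subst F).toRingHom with commutes' := fun a => hfixA a a.2 }
  have hσ : ∀ r : R n, σA r = subst F r := fun _ => rfl
  have haeval : Polynomial.aeval (X (Sum.inl e) : R n) q = 0 := by
    have h := Polynomial.aeval_algHom_apply σA (X (Sum.inr e) : R n) q
    rw [hσ, hσ, subst_X_inr, if_pos (Finset.mem_insert_self e E), hq, hkill] at h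
    exact h
  refine ⟨q, ?_, haeval⟩
  rintro rfl
  apply hne
  rw [← hq, map_zero]

/-! ## The count -/

/-- **One adversary round.**  If the identified `x`-variables `x_E` are algebraic over Alice's `< T`
messages (the invariant) and two cells are to spare, then the generic output cell of `E` is new and
identifying it preserves the invariant. -/
theorem adversary_step (E : Finset (Cell n)) (hInv : XE E ⊆ (Mat n).closure P.AM)
    (hroom : E.card + 2 ≤ Fintype.card (Cell n)) :
    P.genOut E ∉ E ∧ XE (insert (P.genOut E) E) ⊆ (Mat n).closure P.AM := by
  -- two free cells
  obtain ⟨e₀, he₀⟩ : ∃ e₀, e₀ ∉ E := by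
    by_contra hall
    push Not at hall
    have : Finset.univ ⊆ E := fun c _ => hall c
    have := Finset.card_le_card this
    rw [Finset.card_univ] at this
    omega
  have he : P.genOut E ∉ E := P.genOut_not_mem E he₀
  set e := P.genOut E with hedef
  obtain ⟨e₁, he₁⟩ : ∃ e₁, e₁ ∉ insert e E := by
    by_contra hall
    push Not at hall
    have hsub : Finset.univ ⊆ insert e E := fun c _ => hall c
    have := Finset.card_le_card hsub
    rw [Finset.card_univ, Finset.card_insert_of_notMem he] at this
    omega
  refine ⟨he, ?_⟩
  obtain ⟨t, ht, hne, hkill⟩ := P.exists_gen_killed E he₁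
  have halg := P.isAlgebraic_of_killed E he ht hne hkill
  rw [← mem_closure_iff_isAlgebraic] at halg
  -- rewrite the complement as a finset coercion and drop the free `y`'s
  have hW : YC ((↑(insert e E) : Set (Cell n))ᶜ) = YC (n := n) (↑((insert e E)ᶜ) : Set (Cell n)) := by
    rw [Finset.coe_compl]
  rw [hW] at halg
  have hZ : (P.AM ∪ XE E : Set (R n)) ⊆ (Mat n).closure Xall := by
    rintro q (hq | ⟨c, -, rfl⟩)
    · exact mem_closure_Xall_of_mem_xSub (P.AM_subset_xSub hq)
    · exact (Mat n).subset_closure Xall (by simp) ⟨c, rfl⟩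
  have hxe : (X (Sum.inl e) : R n) ∈ (Mat n).closure Xall :=
    (Mat n).subset_closure Xall (by simp) ⟨e, rfl⟩
  have hcl := mem_closure_of_mem_closure_union_YC _ hZ hxe _ halg
  -- `cl (AM ∪ x_E) ⊆ cl AM` by the invariant
  have hcl' : (X (Sum.inl e) : R n) ∈ (Mat n).closure P.AM := by
    refine (Mat n).closure_subset_closure_of_subset_closure ?_ hcl
    rintro q (hq | hq)
    · exact (Mat n).subset_closure P.AM (by simp) hq
    · exact hInv hq
  -- the new invariant
  intro q hq
  rw [XE, Finset.coe_insert, Set.image_insert_eq] at hq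
  rcases hq with rfl | hq
  · exact hcl'
  · exact hInv hq

/-- The adversary's sequence of identified sets. -/
def Eseq : ℕ → Finset (Cell n)
  | 0 => ∅
  | i + 1 => insert (P.genOut (Eseq i)) (Eseq i)

/-- Along the adversary's sequence the invariant holds and the sets grow by one cell per round (as long as two cells are to spare). -/
theorem Eseq_invariant (hT : T + 2 ≤ Fintype.card (Cell n)) :
    ∀ i ≤ T + 1, XE (P.Eseq i) ⊆ (Mat n).closure P.AM ∧ (P.Eseq i).card = i := by
  intro i
  induction i with
  | zero => intro _; exact ⟨by simp [Eseq, XE], rfl⟩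
  | succ i ih =>
    intro hi
    obtain ⟨hInv, hcard⟩ := ih (by omega)
    have hstep := P.adversary_step (P.Eseq i) hInv (by omega)
    refine ⟨hstep.2, ?_⟩
    show (insert (P.genOut (P.Eseq i)) (P.Eseq i)).card = i + 1
    rw [Finset.card_insert_of_notMem hstep.1, hcard]

/-- Alice sends at most `T` messages. -/
theorem encard_AM_le : (P.AM : Set (R n)).encard ≤ T := by
  have h1 : (P.AM : Set (R n)).encard ≤ ({t | t < T ∧ Even (P.blk t)} : Set ℕ).encard :=
    Set.encard_image_le _ _
  have h2 : ({t | t < T ∧ Even (P.blk t)} : Set ℕ) ⊆ (↑(Finset.range T) : Set ℕ) := by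
    intro t ht; simpa using ht.1
  have h3 := Set.encard_le_encard h2
  rw [Set.encard_coe_eq_coe_finsetCard, Finset.card_range] at h3
  exact h1.trans h3

end Protocol

/-- `XE E` has `|E|` elements. -/
theorem encard_XE (E : Finset (Cell n)) : (XE E : Set (R n)).encard = E.card := by
  rw [XE, Function.Injective.encard_image, Set.encard_coe_eq_coe_finsetCard]
  intro c c' h
  simpa using X_injective (σ := Var n) (R := ℂ) h

/-- **No correct one-alternation protocol.**  There is no (correct) `Protocol n T` — Alice's rounds
first, Bob's second, depth `T` — for the KW game of `per_n` once `T + 2 ≤ n²`. -/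
theorem Protocol.false {T : ℕ} (P : Protocol n T) (hT : T + 2 ≤ Fintype.card (Cell n)) : False := by
  obtain ⟨hInv, hcard⟩ := P.Eseq_invariant hT (T + 1) le_rfl
  set E := P.Eseq (T + 1)
  have hind : (Mat n).Indep (XE E : Set (R n)) := by
    have : (XE E : Set (R n)) = (fun v => (X v : R n)) '' (Sum.inl '' (E : Set (Cell n))) := by
      rw [XE, Set.image_image]
    rw [this]
    exact indep_image_X _
  have h := hind.encard_le_eRk_of_subset hInv
  rw [Matroid.eRk_closure_eq, encard_XE, hcard] at h
  have h' := (h.trans ((Mat n).eRk_le_encard _)).trans P.encard_AM_le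
  norm_cast at h'
  omega

end

end Summit.ValiantsHypothesis.ValiantsHypothesis.Theorems.AlgebraicKWGames.OneAlt
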